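/-
Origin: expansion seat `planner-pub-hodgecm-pv02-g3-0`, handover #5 2026-08-18T05:28:13Z (`HOME/pub-hodgecm-pv02-g3/lean/Pv02g3/PerL34/BallCRKType.lean`, md5 613af0ce, 172 lines);
landed by the gen-6 packager in gate run 23 as `HodgeCM/PerL34/BallCRKType.lean` (import ^import Pv[0-9]+g[0-9]+\.PerL34\.→import HodgeCM.PerL34. ×1; stripped 4 #print/#check/#eval lines).
-/
/-
Origin: planner-pub-hodgecm-pv02-g3-0 (unit pub-hodgecm-pv02-g3, DAG-NODE PROVER #02 gen 3), 2026-08-18.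
Proposed tree path: `HodgeCM/PerL34/BallCRKType.lean` (new, additive; lands AFTER `BallCR` (pv02-g3, run 22)).
PACKAGER: `import Pv02g3.PerL34.BallCR` becomes `import HodgeCM.PerL34.BallCR`.  KERNEL: nothing cited, nothing asserted.
-/
import Summits.HodgeConjecture.HodgeCM.PerL34.BallCR_2

/-!
# The `K`-type of the ball dictionary: `ballFD.Cochain ⊂ (C¹(U(2,1)) ⊗ 𝔭₊^∨)^{K}`

A referee-facing READING check, as theorems.  Let `K = Stab(x₀) ⊂ U(2,1)` (`x₀ = 0 ∈ 𝔹²`).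

* `stab_upper`, `stab_lower`, `stab_norm22`: `k ∈ K` is block-diagonal, `k = diag(A, d)`, `|d| = 1`.
* `Jac_of_stab`: its Jacobian at `x₀` is `d⁻¹ A`; `Jac_mul_of_stab`: `k ↦ Jac k x₀` is multiplicative on `K`.
* `mat_mul_Xplus_of_stab`: **`Ad(k)` on `𝔭₊ = {X₊(v)}` is `Jac k x₀`**: `k · X₊(v) = X₊(Jac k x₀ · v) · k`.
* `R_mul_of_stab`, `cochain_rightK`, `hol_rightK`: **every frame reading, in particular every element of
  `ballFD.Cochain` / `ballFD.Hol`, satisfies `φ(g k) = ᵗ(Jac k x₀) · φ(g)`** — i.e. it is a `K`-equivariant function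
  of type `𝔭₊^∨` (the contragredient: `τ^∨(k)⁻¹ = ᵗτ(k)` for `τ(k) = Ad(k)|_{𝔭₊} = Jac k x₀`), which is [BW] VII 2.5's
  `C^{1,0} = (C^∞(G) ⊗ 𝔭₊^∨)^K` up to the regularity class (we use `C¹`, which only weakens hypotheses).
* `Xp_add_I_Xp`, `Xp_sub_I_Xp`: `X_v + iX_{iv} = 2·X₋(v̄) ∈ 𝔭₋` and `X_v − iX_{iv} = 2·X₊(v) ∈ 𝔭₊` — so the
  operators `BallCR.Xminus v = R(X_v) + i R(X_{iv})` (see `BallCRExp.Xminus_eq_lieDeriv`) are `R(𝔭₋)`.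
-/

noncomputable section

open Complex ComplexConjugate
open scoped Matrix

namespace HodgeCM
namespace PerL34
namespace BallCR

open HodgeCM.PerL34.BallModel HodgeCM.PerL34.BallSpans HodgeCM.PerL34.BallFrame

/-! ## 1. Right `K`-equivariance of frame readings -/

/-- For `k ∈ Stab(x₀)`: `R u (g k) = ᵗ(Jac k x₀) · R u g`. -/
theorem R_mul_of_stab (u : Ball → (Fin 2 → ℂ)) (g k : U21) (hk : k • x₀ = x₀) :
    R u (g * k) = (Jac k x₀)ᵀ *ᵥ R u g := by
  rw [R_mul, hk, ← R_eq_transpose_Jac]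

/-- Every cochain of the ball dictionary is right-`K`-equivariant of type `ᵗ(Jac k x₀)`. -/
theorem cochain_rightK {φ : U21 → (Fin 2 → ℂ)} (hφ : φ ∈ ballFD.Cochain) {k : U21} (hk : k • x₀ = x₀)
    (g : U21) : φ (g * k) = (Jac k x₀)ᵀ *ᵥ φ g := by
  rcases (Submodule.mem_map).1 hφ with ⟨u, -, rfl⟩
  exact R_mul_of_stab u g k hk

/-- (Ported verbatim from the HodgeCMPerL package; no docstring in the source.) -/
theorem hol_rightK {φ : U21 → (Fin 2 → ℂ)} (hφ : φ ∈ ballFD.Hol) {k : U21} (hk : k • x₀ = x₀)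
    (g : U21) : φ (g * k) = (Jac k x₀)ᵀ *ᵥ φ g :=
  cochain_rightK (Hol_le_Cochain hφ) hk g

/-- On `K` the Jacobian cocycle is a homomorphism. -/
theorem Jac_mul_of_stab (k₁ k₂ : U21) (hk₂ : k₂ • x₀ = x₀) : Jac (k₁ * k₂) x₀ = Jac k₁ x₀ * Jac k₂ x₀ := by
  rw [Jac_mul, hk₂]

/-! ## 2. The stabiliser is block-diagonal -/

/-- (Ported verbatim from the HodgeCMPerL package; no docstring in the source.) -/
theorem W3_x₀ (g : U21) (i : Fin 3) : W3 g x₀ i = mat g i 2 := by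
  rw [W3_apply]; simp

/-- (Ported verbatim from the HodgeCMPerL package; no docstring in the source.) -/
theorem mat22_ne_zero (g : U21) : mat g 2 2 ≠ 0 := by
  rw [← W3_x₀]; exact W3_2_ne_zero g x₀

/-- `k • x₀ = x₀` iff the upper-right column of `k` vanishes. -/
theorem stab_iff (k : U21) : k • x₀ = x₀ ↔ ∀ i : Fin 2, mat k (Fin.castSucc i) 2 = 0 := by
  constructor
  · intro hk i
    have h := congrArg (fun z : Ball => z.1 i) hk
    simp only [smul_val, W3_x₀, x₀_val, Pi.zero_apply] at h
    rcases div_eq_zero_iff.1 h with h | h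
    · exact h
    · exact absurd h (mat22_ne_zero k)
  · intro h
    apply Ball.ext; intro i
    rw [smul_val, W3_x₀, W3_x₀, h i, zero_div, x₀_val, Pi.zero_apply]

/-- (Ported verbatim from the HodgeCMPerL package; no docstring in the source.) -/
theorem stab_upper {k : U21} (hk : k • x₀ = x₀) (i : Fin 2) : mat k (Fin.castSucc i) 2 = 0 := (stab_iff k).1 hk i

/-- the `(i, j)` entry of the defining relation `kᴴ J k = J`, written out -/
theorem mem_entry (g : U21) (i j : Fin 3) :
    conj (mat g 0 i) * mat g 0 j + conj (mat g 1 i) * mat g 1 j - conj (mat g 2 i) * mat g 2 j = J i j := by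
  have h := congrArg (fun A => A i j) (mat_mem g)
  simpa [Matrix.mul_apply, Fin.sum_univ_three, J, Matrix.diagonal, Matrix.conjTranspose_apply, Matrix.of_apply,
    sub_eq_add_neg] using h

/-- (Ported verbatim from the HodgeCMPerL package; no docstring in the source.) -/
theorem stab_norm22 {k : U21} (hk : k • x₀ = x₀) : conj (mat k 2 2) * mat k 2 2 = 1 := by
  have h := mem_entry k 2 2
  have h0 : mat k 0 2 = 0 := stab_upper hk 0
  have h1 : mat k 1 2 = 0 := stab_upper hk 1
  have hJ : J 2 2 = -1 := by simp [J, Matrix.diagonal]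
  rw [h0, h1, hJ] at h
  simp only [map_zero, zero_mul, zero_add, zero_sub] at h
  linear_combination -h

/-- the lower-left row of `k ∈ K` vanishes too -/
theorem stab_lower {k : U21} (hk : k • x₀ = x₀) (j : Fin 2) : mat k 2 (Fin.castSucc j) = 0 := by
  have h := mem_entry k 2 (Fin.castSucc j)
  have h0 : mat k 0 2 = 0 := stab_upper hk 0
  have h1 : mat k 1 2 = 0 := stab_upper hk 1
  rw [h0, h1] at h
  have hJ : J 2 (Fin.castSucc j) = 0 := by fin_cases j <;> simp [J, Matrix.diagonal]
  rw [hJ] at h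
  simp only [map_zero, zero_mul, zero_add, zero_sub, neg_eq_zero, mul_eq_zero] at h
  rcases h with h | h
  · exact absurd ((map_eq_zero _).1 h) (mat22_ne_zero k)
  · exact h

/-- For `k ∈ K`: `Jac k x₀ = d⁻¹ A` (`A` the upper-left block, `d = k₂₂`). -/
theorem Jac_of_stab {k : U21} (hk : k • x₀ = x₀) (i j : Fin 2) :
    Jac k x₀ i j = mat k (Fin.castSucc i) (Fin.castSucc j) / mat k 2 2 := by
  have h22 := mat22_ne_zero k
  simp only [Jac, Matrix.of_apply, W3_x₀, stab_upper hk, zero_mul, sub_zero]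
  field_simp

/-! ## 3. `𝔭₊`, `𝔭₋` and `Ad(K)` -/

/-- `3 × 3` complex matrices. -/
abbrev Mat3 : Type := Matrix (Fin 3) (Fin 3) ℂ

/-- `X₊(v) ∈ 𝔭₊` (upper-right block). -/
def Xplus (v : Fin 2 → ℂ) : Mat3 := !![0, 0, v 0; 0, 0, v 1; 0, 0, 0]

/-- `X₋(w) ∈ 𝔭₋` (lower-left block). -/
def Xlow (w : Fin 2 → ℂ) : Mat3 := !![0, 0, 0; 0, 0, 0; w 0, w 1, 0]

/-- (Ported verbatim from the HodgeCMPerL package; no docstring in the source.) -/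
theorem Xp_eq (v : Fin 2 → ℂ) : Xp v = Xplus v + Xlow (star v) := by
  ext i j; fin_cases i <;> fin_cases j <;> simp [Xp, Xplus, Xlow]

/-- `X_v + i X_{iv} = 2 X₋(v̄) ∈ 𝔭₋`. -/
theorem Xp_add_I_Xp (v : Fin 2 → ℂ) : Xp v + I • Xp (I • v) = (2 : ℂ) • Xlow (star v) := by
  ext i j
  fin_cases i <;> fin_cases j <;> simp [Xp, Xlow, Matrix.smul_apply, two_mul]
  all_goals (simp only [← mul_assoc, Complex.I_mul_I]; ring)

/-- `X_v − i X_{iv} = 2 X₊(v) ∈ 𝔭₊`. -/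
theorem Xp_sub_I_Xp (v : Fin 2 → ℂ) : Xp v - I • Xp (I • v) = (2 : ℂ) • Xplus v := by
  ext i j
  fin_cases i <;> fin_cases j <;> simp [Xp, Xplus, Matrix.smul_apply, two_mul]
  all_goals (simp only [← mul_assoc, Complex.I_mul_I]; ring)

/-- **`Ad(k)|_{𝔭₊} = Jac k x₀`**: `k · X₊(v) = X₊(Jac k x₀ · v) · k` for `k ∈ K`. -/
theorem mat_mul_Xplus_of_stab {k : U21} (hk : k • x₀ = x₀) (v : Fin 2 → ℂ) :
    mat k * Xplus v = Xplus (Jac k x₀ *ᵥ v) * mat k := by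
  have h22 := mat22_ne_zero k
  have hu0 : mat k 0 2 = 0 := stab_upper hk 0
  have hu1 : mat k 1 2 = 0 := stab_upper hk 1
  have hl0 : mat k 2 0 = 0 := stab_lower hk 0
  have hl1 : mat k 2 1 = 0 := stab_lower hk 1
  have hJ : ∀ i j : Fin 2, Jac k x₀ i j = mat k (Fin.castSucc i) (Fin.castSucc j) / mat k 2 2 := Jac_of_stab hk
  ext i j
  fin_cases i <;> fin_cases j <;>
    simp [Matrix.mul_apply, Fin.sum_univ_three, Xplus, Matrix.mulVec, dotProduct, Fin.sum_univ_two, hJ, hu0, hu1,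
      hl0, hl1]
  all_goals (field_simp)

/-- The same for the contragredient on `𝔭₊^∨ ≅ ℂ²` (column vectors): the type by which cochains transform,
`ᵗ(Jac k x₀)`, is `ᵗ(Ad(k)|_{𝔭₊})`, i.e. `τ^∨(k⁻¹)` — the `(C¹ ⊗ 𝔭₊^∨)^K` convention `φ(gk) = τ^∨(k)⁻¹ φ(g)`.
Recorded as the pair (`cochain_rightK`, `mat_mul_Xplus_of_stab`). -/
theorem cochain_type_summary {φ : U21 → (Fin 2 → ℂ)} (hφ : φ ∈ ballFD.Cochain) {k : U21} (hk : k • x₀ = x₀) :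
    (∀ g, φ (g * k) = (Jac k x₀)ᵀ *ᵥ φ g) ∧ ∀ v, mat k * Xplus v = Xplus (Jac k x₀ *ᵥ v) * mat k :=
  ⟨cochain_rightK hφ hk, mat_mul_Xplus_of_stab hk⟩

end BallCR
end PerL34
end HodgeCM

end

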